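import Summits.AtomisticToContinuum.HydrodynamicLimit.Theorems.ImplosionDichotomyHsEosLowDensity
import Summits.AtomisticToContinuum.HydrodynamicLimit.Theorems.ImplosionDichotomyPolynomialCompressionLogBudgetShadowing
import Summits.AtomisticToContinuum.HydrodynamicLimit.Theorems.ImplosionDichotomyPolynomialCompressionConditionalExistence
import Summits.AtomisticToContinuum.HydrodynamicLimit.Theorems.ImplosionDichotomyPolynomialCompressionSolutionAPI
import Summits.AtomisticToContinuum.HydrodynamicLimit.Theorems.ImplosionDichotomyTypeOneRateTools
import Literature.Analysis.FluidPDE.CompressibleEulerImplosionRatesAssembly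

/-!
# Exterior development, uniformly in `σ` — stub `stub_exteriorDevelopment` (line `r2-one-mode-two-conditions`, v8e)

Crux `Summit.AtomisticToContinuum.HydrodynamicLimit.Theses.ImplosionDichotomy.DenseExcursion`
(stmt-AtomisticToContinuum-12586), skeleton v8e of the line `r2-one-mode-two-conditions`, registered stub
`stub_exteriorDevelopment : ExteriorDevelopment` (definition `ExteriorDevelopment` verbatim from the skeleton, §0f).

**Statement.** Let `(ρ₁, u₁, θ₁ = K ρ₁^{2/3})` be a classical `σ = 0` (monatomic ideal gas) solution on `[0, T₁)` with
data `(ρ₀, u₀, θ₀)`, and `ρs σ` (`0 < σ < σ₁`) smooth positive densities with `‖∂ⁿ(ρs σ − ρ₀)‖_∞ ≤ Cₙ σ³` for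
every `n`. Then for every `0 < T₂ < T₁` there is `σ₂ ∈ (0, σ₁]` such that for `0 < σ < σ₂` the hard-sphere development
of `(ρs σ, u₀, θ₀)` exists classically on `[0, T₂)`.

**Proof (assembly, no PDE estimate redone).** Three landed theorems of the sibling crux `PolynomialCompression`:
* the equation of state `hsEosLowDensity_proof` (`η₀`, `F` analytic, `F = hsExcessFreeEnergy` on `[0, η₀)`,
  `F 0 = 0`, `F′ 0 = 2π/3`);
* conditional existence `stub_conditionalExistence`: a packing threshold `η₁ > 0` such that uniform `(M, η₁)` a-priori
  bounds of all solutions with given smooth positive data on `[0, T)`, `T ≤ T'`, give a classical solution on `[0, T')`;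
* the polynomial-loss shadowing a-priori bounds `stub_logBudgetShadowing`, applied to the reference RESTRICTED to the
  compact sub-horizon `T₃ := (T₁ + T₂)/2` (`isHardSphereEulerSolution_restrict`), where its Type-I / polynomial / floor
  hypotheses hold trivially: on `[0, T₃] ⊂ [0, T₁)` the first space derivatives of `u₁`, `ρ₁^{1/3}` are bounded by some
  `B` (`IsSmoothSpaceTimeOn.partialDeriv`, `exists_norm_le_of_isCompact`), and `B ≤ B T₃/(T₃ − t)`; all space
  derivatives of the lifts are bounded (`CaolaboraEtAl2025.exists_bound_iteratedFDeriv_lift`, exponent `pₙ := 0`);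
  the density is bounded below (`exists_pos_le_slice`, exponent `p_l := 0`). With `η := η₁` it returns `e, σ₂, M`
  and the `(M, η₁)`-bounds of every solution with the data `(ρs σ, u₀, θ₀)` on horizons `T ≤ T₃ − σ^e/2`.
Shrinking `σ₂` below `(2(T₃ − T₂))^{1/e}` makes `T₂ ≤ T₃ − σ^e/2`, and `stub_conditionalExistence` with `T' := T₂`
concludes; the data `u₀ = u₁ 0`, `θ₀ = θ₁ 0 > 0` are smooth as slices of the classical reference.
-/

noncomputable section

open Set Filter Topology
open scoped ContDiff

namespace Summit.AtomisticToContinuum.HydrodynamicLimit.Theorems.R2OneModeTwoConditions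

open Literature.MathematicalPhysics.KineticTheory
open Literature.Analysis.FunctionSpaces

/-! ## The line-posited definition (verbatim: skeleton `r2-one-mode-two-conditions` v8e, §0f) -/

/-- EXTERIOR DEVELOPMENT (uniform-in-σ existence near a classical isentropic ideal solution): let `(ρ₁, u₁, θ₁ = K ρ₁^{2/3})` be a classical
`σ = 0` solution on `[0, T₁)` with data `(ρ₀, u₀, θ₀)`, and `ρs σ` (`0 < σ < σ₁`) smooth positive densities with
`‖∂ⁿ(ρs σ − ρ₀)‖_∞ ≤ Cₙ σ³` for every `n`. Then for every `T₂ < T₁` there is `σ₂ > 0` such that for `0 < σ < σ₂` the hard-sphere development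
of `(ρs σ, u₀, θ₀)` exists classically on `[0, T₂)`. (Assembly: `stub_logBudgetShadowing` on the reference restricted to `[0, (T₁+T₂)/2]`
gives the `(M, η₁)` a-priori bounds for every solution with these data on horizons `≤ (T₁+T₂)/2 − σ^e/2 ≥ T₂`; `stub_conditionalExistence`
turns them into existence on `[0, T₂)`.) -/
def ExteriorDevelopment : Prop :=
  ∀ (ρ₀ θ₀ : T3 → ℝ) (u₀ : T3 → V3) (K T₁ : ℝ) (ρ₁ θ₁ : ℝ → T3 → ℝ) (u₁ : ℝ → T3 → V3),
    0 < K → 0 < T₁ → IsHardSphereEulerSolution 0 T₁ ρ₁ u₁ θ₁ → (∀ x, ρ₁ 0 x = ρ₀ x) → u₁ 0 = u₀ → θ₁ 0 = θ₀ →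
    (∀ t ∈ Set.Ico 0 T₁, ∀ x, θ₁ t x = K * ρ₁ t x ^ (2 / 3 : ℝ)) →
    ∀ (ρs : ℝ → T3 → ℝ) (σ₁ : ℝ), 0 < σ₁ →
      (∀ σ : ℝ, 0 < σ → σ < σ₁ → Literature.Analysis.FunctionSpaces.Torus.IsSmooth (ρs σ) ∧ ∀ x, 0 < ρs σ x) →
      (∀ n : ℕ, ∃ Cn : ℝ, ∀ σ : ℝ, 0 < σ → σ < σ₁ → ∀ y : EuclideanSpace ℝ (Fin 3),
        ‖iteratedFDeriv ℝ n (Literature.Analysis.FunctionSpaces.Torus.lift (fun x => ρs σ x - ρ₀ x)) y‖ ≤ Cn * σ ^ 3) →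
      ∀ T₂ : ℝ, 0 < T₂ → T₂ < T₁ →
        ∃ σ₂ : ℝ, 0 < σ₂ ∧ σ₂ ≤ σ₁ ∧ ∀ σ : ℝ, 0 < σ → σ < σ₂ →
          ∃ (ρ θ : ℝ → T3 → ℝ) (u : ℝ → T3 → V3),
            IsHardSphereEulerSolution σ T₂ ρ u θ ∧ ρ 0 = ρs σ ∧ u 0 = u₀ ∧ θ 0 = θ₀

/-! ## The trivial rate clauses of a classical solution on a compact sub-horizon -/

namespace ExteriorDevelopmentProof

variable {T₁ T₃ : ℝ} {ρ₁ θ₁ : ℝ → T3 → ℝ} {u₁ : ℝ → T3 → V3}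

/-- **Type-I clause on a compact sub-horizon.** For a classical solution on `[0, T₁)` and `0 < T₃ < T₁`, the first
space derivatives of `u₁` and of `ρ₁^{1/3}` are bounded on `[0, T₃] × 𝕋³` by some `B ≥ 0` (joint smoothness,
compactness), hence by `B T₃ / (T₃ − t)` for `t ∈ [0, T₃)`. [folklore] -/
theorem typeI_of_lt (hE : IsHardSphereEulerSolution 0 T₁ ρ₁ u₁ θ₁) (hT₃₁ : T₃ < T₁) :
    ∃ C : ℝ, ∀ t ∈ Ico 0 T₃, ∀ x, ∀ i : Fin 3, ‖Torus.partialDeriv i (u₁ t) x‖ ≤ C / (T₃ - t) ∧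
      |Torus.partialDeriv i (fun y => ρ₁ t y ^ (1 / 3 : ℝ)) x| ≤ C / (T₃ - t) := by
  have hK : IsCompact (Icc (0 : ℝ) T₃) := isCompact_Icc
  have hKS : Icc (0 : ℝ) T₃ ⊆ Ico 0 T₁ := fun t ht => ⟨ht.1, ht.2.trans_lt hT₃₁⟩
  have hS : UniqueDiffOn ℝ (Ico (0 : ℝ) T₁) := uniqueDiffOn_Ico 0 T₁
  have hsm1 : Torus.IsSmoothSpaceTimeOn (Ico 0 T₁) u₁ := hE.smooth_velocity
  have hsm2 : Torus.IsSmoothSpaceTimeOn (Ico 0 T₁) (fun t y => ρ₁ t y ^ (1 / 3 : ℝ)) :=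
    hE.smooth_density.rpow_const_of_ne fun p hp => (hE.density_pos p.1 (mem_prod.1 hp).1 _).ne'
  have hCu : ∀ i : Fin 3, ∃ C : ℝ, ∀ t ∈ Icc 0 T₃, ∀ x, ‖Torus.partialDeriv i (u₁ t) x‖ ≤ C :=
    fun i => (hsm1.partialDeriv hS i).exists_norm_le_of_isCompact hK hKS
  have hCs : ∀ i : Fin 3, ∃ C : ℝ, ∀ t ∈ Icc 0 T₃, ∀ x,
      ‖Torus.partialDeriv i (fun y => ρ₁ t y ^ (1 / 3 : ℝ)) x‖ ≤ C :=
    fun i => (hsm2.partialDeriv hS i).exists_norm_le_of_isCompact hK hKS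
  choose Cu hCu using hCu
  choose Cs hCs using hCs
  obtain ⟨B, hB⟩ : ∃ B : ℝ, B = ∑ i, (|Cu i| + |Cs i|) := ⟨_, rfl⟩
  have hB0 : 0 ≤ B := by rw [hB]; positivity
  have hBi : ∀ i, |Cu i| ≤ B ∧ |Cs i| ≤ B := by
    intro i
    have h := Finset.single_le_sum (f := fun j : Fin 3 => |Cu j| + |Cs j|) (fun j _ => by positivity)
      (Finset.mem_univ i)
    rw [← hB] at h
    exact ⟨le_trans (le_add_of_nonneg_right (abs_nonneg _)) h, le_trans (le_add_of_nonneg_left (abs_nonneg _)) h⟩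
  refine ⟨B * T₃, fun t ht x i => ?_⟩
  have hl0 : 0 < T₃ - t := sub_pos.2 ht.2
  have hkey : B ≤ B * T₃ / (T₃ - t) := by
    rw [le_div_iff₀ hl0]
    nlinarith [mul_nonneg hB0 ht.1]
  have ht' : t ∈ Icc 0 T₃ := ⟨ht.1, ht.2.le⟩
  refine ⟨(((hCu i t ht' x).trans (le_abs_self _)).trans (hBi i).1).trans hkey, ?_⟩
  have h := hCs i t ht' x
  rw [Real.norm_eq_abs] at h
  exact ((h.trans (le_abs_self _)).trans (hBi i).2).trans hkey

/-- **Polynomial clause on a compact sub-horizon** (exponent `0`): for a classical solution on `[0, T₁)` and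
`T₃ < T₁`, all space derivatives of the lifts of `ρ₁ t`, `u₁ t` are bounded on `[0, T₃) × ℝ³`
(`CaolaboraEtAl2025.exists_bound_iteratedFDeriv_lift` on the compact `[0, T₃]`). [folklore] -/
theorem poly_of_lt (hE : IsHardSphereEulerSolution 0 T₁ ρ₁ u₁ θ₁) (hT₃₁ : T₃ < T₁) :
    ∀ n : ℕ, n ≤ 6 → ∃ Cn pn : ℝ, ∀ t ∈ Ico 0 T₃, ∀ y : EuclideanSpace ℝ (Fin 3),
      ‖iteratedFDeriv ℝ n (Torus.lift (ρ₁ t)) y‖ ≤ Cn * (T₃ - t) ^ (-pn) ∧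
      ‖iteratedFDeriv ℝ n (Torus.lift (u₁ t)) y‖ ≤ Cn * (T₃ - t) ^ (-pn) := by
  intro n _
  have hK : IsCompact (Icc (0 : ℝ) T₃) := isCompact_Icc
  have hKS : Icc (0 : ℝ) T₃ ⊆ Ico 0 T₁ := fun t ht => ⟨ht.1, ht.2.trans_lt hT₃₁⟩
  have hS : UniqueDiffOn ℝ (Ico (0 : ℝ) T₁) := uniqueDiffOn_Ico 0 T₁
  obtain ⟨Cρ, hCρ⟩ :=
    Literature.Analysis.FluidPDE.CaolaboraEtAl2025.exists_bound_iteratedFDeriv_lift hS hK hKS n hE.smooth_density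
  obtain ⟨Cu, hCu⟩ :=
    Literature.Analysis.FluidPDE.CaolaboraEtAl2025.exists_bound_iteratedFDeriv_lift hS hK hKS n hE.smooth_velocity
  refine ⟨max Cρ Cu, 0, fun t ht y => ?_⟩
  have ht' : t ∈ Icc 0 T₃ := ⟨ht.1, ht.2.le⟩
  rw [neg_zero, Real.rpow_zero, mul_one]
  exact ⟨(hCρ t ht' y).trans (le_max_left _ _), (hCu t ht' y).trans (le_max_right _ _)⟩

/-- **Floor clause on a compact sub-horizon** (exponent `0`): for a classical solution on `[0, T₁)` and
`0 ≤ T₃ < T₁`, the density is bounded below by a positive constant on `[0, T₃) × 𝕋³` (`exists_pos_le_slice`).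
[folklore] -/
theorem floor_of_lt (hE : IsHardSphereEulerSolution 0 T₁ ρ₁ u₁ θ₁) (hT₃ : 0 ≤ T₃) (hT₃₁ : T₃ < T₁) :
    ∃ cl pl : ℝ, 0 < cl ∧ ∀ t ∈ Ico 0 T₃, ∀ x, cl * (T₃ - t) ^ pl ≤ ρ₁ t x := by
  obtain ⟨c, hc0, hc⟩ := exists_pos_le_slice hE.smooth_density hE.density_pos hT₃ hT₃₁
  exact ⟨c, 0, hc0, fun t ht x => by rw [Real.rpow_zero, mul_one]; exact hc t ⟨ht.1, ht.2.le⟩ x⟩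

/-- **Smallness of the exit margin**: for `e, δ > 0` there is `σ₃ > 0` with `σ^e / 2 ≤ δ` for `0 < σ < σ₃`
(`σ₃ := (2δ)^{1/e}`, monotonicity of `rpow`). [folklore] -/
theorem exists_rpow_half_le {e δ : ℝ} (he : 0 < e) (hδ : 0 < δ) :
    ∃ σ₃ : ℝ, 0 < σ₃ ∧ ∀ σ : ℝ, 0 < σ → σ < σ₃ → σ ^ e / 2 ≤ δ := by
  refine ⟨(2 * δ) ^ (1 / e), Real.rpow_pos_of_pos (by positivity) _, fun σ hσ hσ₃ => ?_⟩
  have h1 : σ ^ e < ((2 * δ) ^ (1 / e)) ^ e := Real.rpow_lt_rpow hσ.le hσ₃ he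
  have h2 : ((2 * δ) ^ (1 / e)) ^ e = 2 * δ := by
    rw [← Real.rpow_mul (by positivity), one_div, inv_mul_cancel₀ he.ne', Real.rpow_one]
  linarith [h1.trans_eq h2]

end ExteriorDevelopmentProof

open ExteriorDevelopmentProof

/-! ## The exterior development (stub M4) -/

/-- **EXTERIOR DEVELOPMENT** (stub M4 of the line `r2-one-mode-two-conditions`, v8e): uniform-in-`σ` classical existence
on `[0, T₂)`, `T₂ < T₁`, of the hard-sphere developments of data `(ρs σ, u₀, θ₀)` that are `σ³`-close in every `Cⁿ` to
the data of a classical isentropic ideal (`σ = 0`) solution on `[0, T₁)`. Assembly of `hsEosLowDensity_proof`,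
`stub_conditionalExistence` (threshold `η₁`) and `stub_logBudgetShadowing` on the reference restricted to
`[0, (T₁ + T₂)/2)` (trivial Type-I / polynomial / floor clauses `typeI_of_lt`, `poly_of_lt`, `floor_of_lt`), with
`σ₂` shrunk so that `T₂ ≤ (T₁ + T₂)/2 − σ^e/2` (`exists_rpow_half_le`). [folklore] -/
theorem stub_exteriorDevelopment : ExteriorDevelopment := by
  intro ρ₀ θ₀ u₀ K T₁ ρ₁ θ₁ u₁ hK hT₁ hE₁ hρ₁0 hu₁0 hθ₁0 hisen ρs σ₁ hσ₁ hρs hstat T₂ hT₂ hT₂₁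
  subst hu₁0 hθ₁0
  -- the equation of state (route support, proved)
  obtain ⟨η₀, hη₀, F, hF, hEq, hF0, hF', -⟩ := hsEosLowDensity_proof
  -- the existence theory and its packing threshold `η₁` (depends on the equation of state only)
  obtain ⟨η₁, hη₁, Hex⟩ := stub_conditionalExistence η₀ hη₀ F hF hEq hF0 hF'
  -- the compact sub-horizon `T₃ := (T₁ + T₂)/2` and the restricted reference
  obtain ⟨T₃, hT₃⟩ : ∃ T₃ : ℝ, T₃ = (T₁ + T₂) / 2 := ⟨_, rfl⟩
  have hT₃0 : 0 < T₃ := by rw [hT₃]; linarith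
  have hT₃₁ : T₃ < T₁ := by rw [hT₃]; linarith
  have hT₂₃ : T₂ < T₃ := by rw [hT₃]; linarith
  have hE₃ : IsHardSphereEulerSolution 0 T₃ ρ₁ u₁ θ₁ := isHardSphereEulerSolution_restrict hE₁ hT₃₁.le
  have hisen₃ : ∀ t ∈ Ico 0 T₃, ∀ x, θ₁ t x = K * ρ₁ t x ^ (2 / 3 : ℝ) :=
    fun t ht x => hisen t ⟨ht.1, ht.2.trans hT₃₁⟩ x
  -- the a-priori shadowing bounds on horizons `≤ T₃ - σ^e/2`, at the packing target `η₁`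
  obtain ⟨e, he, σ₂, hσ₂, hσ₂₁, Hap⟩ :=
    stub_logBudgetShadowing η₀ hη₀ F hF hEq hF0 hF' ρ₀ (θ₁ 0) (u₁ 0) T₃ K ρ₁ θ₁ u₁ hT₃0 hK hE₃ hρ₁0 rfl rfl
      hisen₃ (typeI_of_lt hE₁ hT₃₁) (poly_of_lt hE₁ hT₃₁) (floor_of_lt hE₁ hT₃0.le hT₃₁) ρs σ₁ hσ₁ hρs hstat
      η₁ hη₁
  -- smallness of the exit margin `σ^e/2` against `T₃ - T₂`
  obtain ⟨σ₃, hσ₃, hsmall⟩ := exists_rpow_half_le he (sub_pos.2 hT₂₃)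
  -- regularity and positivity of the data `u₁ 0`, `θ₁ 0` (slices of the classical reference)
  have h0 : (0 : ℝ) ∈ Ico 0 T₁ := ⟨le_rfl, hT₁⟩
  have hθs : Torus.IsSmooth (θ₁ 0) := hE₁.smooth_temperature.isSmooth_slice h0
  have hus : Torus.IsSmooth (u₁ 0) := hE₁.smooth_velocity.isSmooth_slice h0
  have hθpos : ∀ x, 0 < θ₁ 0 x := hE₁.temperature_pos 0 h0
  refine ⟨min σ₂ σ₃, lt_min hσ₂ hσ₃, (min_le_left _ _).trans hσ₂₁, fun σ hσ hσlt => ?_⟩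
  have hσσ₂ : σ < σ₂ := hσlt.trans_le (min_le_left _ _)
  have hσσ₃ : σ < σ₃ := hσlt.trans_le (min_le_right _ _)
  have hσσ₁ : σ < σ₁ := hσσ₂.trans_le hσ₂₁
  obtain ⟨-, hpack, M, hM, Hbnd⟩ := Hap σ hσ hσσ₂
  have hT₂le : T₂ ≤ T₃ - σ ^ e / 2 := by linarith [hsmall σ hσ hσσ₃]
  obtain ⟨hsm, hpos⟩ := hρs σ hσ hσσ₁
  -- conditional existence on `[0, T₂)` fed with the a-priori bounds
  exact Hex σ hσ (ρs σ) (θ₁ 0) (u₁ 0) hsm hθs hus hpos hθpos hpack T₂ M hT₂ hM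
    fun T hT ρ θ u hs h1 h2 h3 t ht x => (Hbnd T (hT.trans hT₂le) ρ θ u hs h1 h2 h3 t ht x).1

end Summit.AtomisticToContinuum.HydrodynamicLimit.Theorems.R2OneModeTwoConditions

end
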